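import Summits.QuantumFields.YangMills.Theorems.UnitScaleTiltProp7IterLinRightInverse
import Literature.MathematicalPhysics.QuantumFieldTheory.Balaban1983to89.B10StarCount
import HarnessLib

/-!
# Route `UnitScaleTilt`, crux K1 «MinimiserStabilityRegPr» (stmt-QuantumFields-19200), registered stub `stub_prop7From14` (leaf V3 «Prop 7 from a background (14)») —
# D1c (ii) FLAT, k-FOLD: **THE `ℓ¹ → ℓ¹` BOUND OF THE FAR-FACE RIGHT INVERSE OF THE TRUE k-FOLD LINEARISED (0.4)-CONSTRAINT**,
# `Σ_b‖Y(b)‖ ≤ L^{k(d−1)}·Σ_c‖B(c)‖` (`exists_rightInverse_iterLin_l1`)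

Cell `ym3-torus` ∕ fleet seat `ym-ust-19200-p1` (gen 5).  The p2 lineage's `Prop7AvgLinearisation.exists_rightInverse_iterLin` (p521175) gives, for the k-fold composite
`Q^{(k)}` of the true one-step linearisation `linAvg` at the flat background, a right inverse built from the far-face field of [Balaban1984PropagatorsI] (1.12) with
the SUP bound `max‖Y‖ ≤ max‖B‖` (constant one).  The `ℓ²` growth assembly of this seat (`Prop7GrowthAssembly.growth_of_growthModLin(_proj)`, p528174/p532939) and
the multiplier duality of gen 4 (`Prop7MultiplierDuality.abs_le_of_adjoint_of_rightInverse_l1`, p525506) consume instead the `ℓ¹ → ℓ¹` bound of a right inverse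
(CARD-19200-V3-g4, D1c (ii): «add the `ℓ¹` bound»).  For the far-face field it is a COUNT: `faceField(L⁻¹B)` carries `B(c)` on the `L^{d−1}` bonds of `B(c₋)`
crossing the far face and `0` elsewhere, so `Σ_b‖faceField(L⁻¹B)(b)‖ ≤ L^{d−1}Σ_c‖B(c)‖` (one step), and `L^{k(d−1)}` after `k` steps — the multiplier scale
`|μ| ≤ L^{k(d−1)}max|J|` of the `ℓ²` route's linear term (`= ε₀η` at d = 3 under print's divergence clause).

WHAT IS PROVED (sorry-free, no definition; [folklore] counting): `val_blockSite_mod`, `sum_eq_sum_blockSite`, `card_filter_offset_le` (`#{r : r_μ = L−1} ≤ L^{d−1}`),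
`sum_norm_faceField_inv_le` (one step), **`exists_rightInverse_iterLin_l1`** (k-fold: `Q^{(k)}Y = B`, `max‖Y‖ ≤ max‖B‖`, `Σ‖Y‖ ≤ L^{k(d−1)}Σ‖B‖`).

References: T. Bałaban, CMP 95 (1984) 17–40 [Balaban1984PropagatorsI] ((1.11)–(1.12) p.19); CMP 102 (1985) 277–309 [Balaban1985Variational] ((45)–(46) p.285).
-/

noncomputable section

open scoped BigOperators Matrix.Norms.L2Operator Matrix

namespace Summit.QuantumFields.YangMills.Theorems.Prop7IterLinL1

open Literature.MathematicalPhysics.QuantumFieldTheory.Balaban1983to89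
open Finset T4Continuum AveragingRT BlockAveraging BlockAveragingEMLLinearised LatticeFieldCalculus B5Eq112RenormTransf
open B10StarCount (sum_pbond)
open Summit.QuantumFields.YangMills.Theorems.Prop7AvgLinearisation (linAvg_faceField_inv norm_faceField_inv_le)

variable {P : Params} {j : ℕ}

/-! ## §1 Block bookkeeping -/

/-- The `μ`-offset of a block site: `(blockSite y r)_μ mod L = r_μ` (standing range). [folklore] -/
theorem val_blockSite_mod (hj : j + 1 ≤ P.m + P.K) (y : Site P (j + 1)) (r : Fin P.d → Fin P.L) (μ : Fin P.d) :
    ((Site.blockSite y r) μ).val % P.L = r μ := by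
  rw [Site.val_blockSite hj, Nat.mul_add_mod', Nat.mod_eq_of_lt (r μ).isLt]

/-- A sum over the fine torus is the sum over blocks of the sums over block offsets (standing range). [folklore] -/
theorem sum_eq_sum_blockSite {M : Type*} [AddCommMonoid M] (hj : j + 1 ≤ P.m + P.K) (F : Site P j → M) :
    ∑ x, F x = ∑ y : Site P (j + 1), ∑ r : Fin P.d → Fin P.L, F (Site.blockSite y r) := by
  classical
  rw [← Finset.sum_fiberwise_of_maps_to (s := Finset.univ) (t := Finset.univ) (g := blockOf) (fun _ _ => Finset.mem_univ _) F]
  refine Finset.sum_congr rfl fun y _ => ?_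
  have hmem : ∀ x : Site P j, blockOf x = y ↔ x ∈ ({x ∈ Finset.univ | blockOf x = y} : Finset (Site P j)) := fun x => by simp
  let e : (Fin P.d → Fin P.L) ≃ ↥({x ∈ Finset.univ | blockOf x = y} : Finset (Site P j)) :=
    (Site.blockEquiv hj y).symm.trans (Equiv.subtypeEquivRight hmem)
  rw [← Finset.sum_coe_sort _ F, ← Equiv.sum_comp e (fun a => F a.1)]
  exact Finset.sum_congr rfl fun r _ => rfl

/-- **AT MOST `L^{d−1}` OFFSETS LIE ON A FACE**: `#{r : Fin d → Fin L | r_μ = L − 1} ≤ L^{d−1}` (restriction to the other coordinates is injective). [folklore] -/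
theorem card_filter_offset_le (μ : Fin P.d) (s : Fin P.L) :
    ((univ : Finset (Fin P.d → Fin P.L)).filter fun r => r μ = s).card ≤ P.L ^ (P.d - 1) := by
  classical
  have hcard : Fintype.card (↥(univ.erase μ) → Fin P.L) = P.L ^ (P.d - 1) := by
    rw [Fintype.card_fun, Fintype.card_fin, Fintype.card_coe, Finset.card_erase_of_mem (Finset.mem_univ μ), Finset.card_univ, Fintype.card_fin]
  rw [← hcard, ← Finset.card_univ]
  refine Finset.card_le_card_of_injOn (fun r => fun ν : ↥(univ.erase μ) => r ν) (fun _ _ => Finset.mem_univ _) ?_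
  intro r hr r' hr' hrr'
  rw [Finset.coe_filter, Set.mem_setOf_eq] at hr hr'
  funext ν
  by_cases hν : ν = μ
  · rw [hν, hr.2, hr'.2]
  · have := congrFun hrr' ⟨ν, Finset.mem_erase.mpr ⟨hν, Finset.mem_univ _⟩⟩
    exact this

/-! ## §2 One step: `Σ_b‖faceField(L⁻¹B)(b)‖ ≤ L^{d−1}·Σ_c‖B(c)‖` -/

variable {n : Type*} [Fintype n] [DecidableEq n]

/-- **THE `ℓ¹` MASS OF THE FAR-FACE FIELD**: `Σ_b‖faceField(L⁻¹B)(b)‖ ≤ L^{d−1}·Σ_c‖B(c)‖` — the field carries `B(c)` on the far-face bonds of `B(c₋)` (at most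
`L^{d−1}` per coarse bond) and vanishes elsewhere. [cite: Balaban1984PropagatorsI, (1.12) p.19] -/
theorem sum_norm_faceField_inv_le (hj : j + 1 ≤ P.m + P.K) (B : PBond P (j + 1) → Matrix n n ℂ) :
    ∑ b : PBond P j, ‖faceField (fun c' => ((P.L : ℝ)⁻¹) • B c') b‖ ≤ (P.L : ℝ) ^ (P.d - 1) * ∑ c : PBond P (j + 1), ‖B c‖ := by
  classical
  have hL : (P.L : ℝ) ≠ 0 := Nat.cast_ne_zero.mpr P.L_pos.ne'
  -- the value at a block bond
  have hval : ∀ (μ : Fin P.d) (y : Site P (j + 1)) (r : Fin P.d → Fin P.L),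
      ‖faceField (fun c' => ((P.L : ℝ)⁻¹) • B c') ⟨Site.blockSite y r, μ⟩‖ = if r μ = ⟨P.L - 1, Nat.sub_lt P.L_pos one_pos⟩ then ‖B ⟨y, μ⟩‖ else 0 := by
    intro μ y r
    unfold faceField
    simp only [val_blockSite_mod hj, Site.blockOf_blockSite hj]
    by_cases hr : r μ = ⟨P.L - 1, Nat.sub_lt P.L_pos one_pos⟩
    · rw [if_pos (by rw [hr]), if_pos hr, smul_smul, mul_inv_cancel₀ hL, one_smul]
    · rw [if_neg (fun h => hr (Fin.ext h)), if_neg hr, norm_zero]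
  rw [sum_pbond, sum_eq_sum_blockSite hj]
  -- reorder to `Σ_μ Σ_y Σ_r`
  rw [show (∑ y : Site P (j + 1), ∑ r : Fin P.d → Fin P.L, ∑ μ : Fin P.d, ‖faceField (fun c' => ((P.L : ℝ)⁻¹) • B c') ⟨Site.blockSite y r, μ⟩‖)
      = ∑ y : Site P (j + 1), ∑ μ : Fin P.d, ∑ r : Fin P.d → Fin P.L, ‖faceField (fun c' => ((P.L : ℝ)⁻¹) • B c') ⟨Site.blockSite y r, μ⟩‖ from
      Finset.sum_congr rfl fun y _ => Finset.sum_comm]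
  simp only [hval, ← Finset.sum_filter, Finset.sum_const, nsmul_eq_mul]
  rw [sum_pbond (fun c : PBond P (j + 1) => ‖B c‖), Finset.mul_sum]
  refine Finset.sum_le_sum fun y _ => ?_
  rw [Finset.mul_sum]
  refine Finset.sum_le_sum fun μ _ => mul_le_mul_of_nonneg_right ?_ (norm_nonneg _)
  exact_mod_cast card_filter_offset_le (P := P) μ _

/-! ## §3 The k-fold right inverse with both bounds -/

omit [DecidableEq n] in
/-- **A k-UNIFORM RIGHT INVERSE OF THE TRUE k-FOLD LINEARISED (0.4)-CONSTRAINT WITH SUP BOUND ONE AND `ℓ¹` BOUND `L^{k(d−1)}`.**  For any family `Q^{(i)}` with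
`Q^{(0)} = id`, `Q^{(i+1)} = Q₁∘Q^{(i)}` (`Q₁ = linAvg`), every `k ≤ m + K`, every level-`k` bond field `B` with `‖B(c)‖ ≤ M`: a finest field `Y` with `Q^{(k)}Y = B`,
`‖Y(b)‖ ≤ M` for all `b`, AND `Σ_b‖Y(b)‖ ≤ (L^{d−1})^k·Σ_c‖B(c)‖` — the far-face construction of p521175 with its `ℓ¹` count. [cite: Balaban1985Variational, (45)-(46) p.285] -/
theorem exists_rightInverse_iterLin_l1 [DecidableEq n]
    (Q : (i : ℕ) → (PBond P 0 → Matrix n n ℂ) → PBond P i → Matrix n n ℂ)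
    (hQ0 : ∀ Y, Q 0 Y = Y) (hQs : ∀ (i : ℕ) (Y : PBond P 0 → Matrix n n ℂ) (c : PBond P (i + 1)), Q (i + 1) Y c = linAvg (Q i Y) c) :
    ∀ k : ℕ, k ≤ P.m + P.K → ∀ (B : PBond P k → Matrix n n ℂ) (M : ℝ), 0 ≤ M → (∀ c, ‖B c‖ ≤ M) →
      ∃ Y : PBond P 0 → Matrix n n ℂ, (∀ c : PBond P k, Q k Y c = B c) ∧ (∀ b : PBond P 0, ‖Y b‖ ≤ M) ∧
        ∑ b : PBond P 0, ‖Y b‖ ≤ ((P.L : ℝ) ^ (P.d - 1)) ^ k * ∑ c : PBond P k, ‖B c‖ := by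
  intro k
  induction k with
  | zero =>
    intro _ B M _ hB
    exact ⟨B, fun c => by rw [hQ0], hB, by rw [pow_zero, one_mul]⟩
  | succ k ih =>
    intro hk B M hM hB
    set X : PBond P k → Matrix n n ℂ := faceField (fun c' => ((P.L : ℝ)⁻¹) • B c') with hX
    have hXB : ∀ c, linAvg X c = B c := fun c => linAvg_faceField_inv hk B c
    have hXM : ∀ c, ‖X c‖ ≤ M := fun c => norm_faceField_inv_le B hM hB c
    have hX1 : ∑ c, ‖X c‖ ≤ (P.L : ℝ) ^ (P.d - 1) * ∑ c, ‖B c‖ := sum_norm_faceField_inv_le hk B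
    obtain ⟨Y, hYX, hYM, hY1⟩ := ih (Nat.le_of_succ_le hk) X M hM hXM
    refine ⟨Y, fun c => ?_, hYM, hY1.trans ?_⟩
    · rw [hQs, show Q k Y = X from funext hYX, hXB]
    · rw [pow_succ, mul_assoc]
      exact mul_le_mul_of_nonneg_left hX1 (by positivity)

end Summit.QuantumFields.YangMills.Theorems.Prop7IterLinL1

end
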